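import Literature.AlgebraicGeometry.Resolution.KollarSplitBoundary
import HarnessLib

/-!
# The componentwise nonmonomial part ignores empty boundary divisors (Kollár 2007, 3.110–3.111 with clause (3) of 3.68)

Topic: `Literature/AlgebraicGeometry/Resolution`. Shared infrastructure for the decomposition of
the named fact `Kollar2007Thm3_107` (`KollarBlowupSequenceFunctors.lean`; J. Kollár, *Lectures on
Resolution of Singularities*, 2007, 3.110–3.111). Clause (3) of the tree's rendering of
Thms. 3.68 / 3.69 (`Kollar2007.IgnoresEmptyDivisors`, amendment of 2026-08-15) asks the functors
to take the same value on `T` and on `T` with a boundary having the same non-empty members in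
the same order (`Triple.withBoundary`, `removeEmpty`). The Step-1 functor of 3.111 is built from
`T ↦ (X, N(I), E)` (`Triple.withNmPart`, `KollarSplitBoundary.lean`); this file PROVES that
`N(I)` — indeed the whole split boundary — does not see empty divisors:

* `Kollar2007.flatMap_boundaryPieces_eq_of_removeEmpty_eq` — boundaries with the same non-empty
  members have the same split boundary (the empty divisor has no pieces, `boundaryPieces_top`);
* `Kollar2007.Triple.splitBoundary_withBoundary`, `mPart_withBoundary`, **`nmPart_withBoundary`**;
* **`Kollar2007.Triple.withNmPart_withBoundary`** — `(T with boundary E').withNmPart =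
  (T.withNmPart) with boundary E'`, an equality of triples.

## Sources

* J. Kollár, *Lectures on Resolution of Singularities* (2007), Def.–Lemma 3.110, 3.111 Step 1
  (p. 176), 3.32 (p. 130 of the held copy). [Kollar2007]
-/

noncomputable section

open CategoryTheory AlgebraicGeometry TopologicalSpace

namespace Literature.AlgebraicGeometry.Resolution

universe u

namespace Kollar2007

variable {X : Scheme.{u}} [NoetherianSpace X]

/-- The split boundary only depends on the non-empty members: splitting `E` and splitting
`removeEmpty E` give the same list (the empty divisor has no pieces). [folklore] -/
theorem flatMap_boundaryPieces_removeEmpty (E : List X.IdealSheafData) :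
    ((removeEmpty E).flatMap fun K => pieceIdeals (boundaryPieces K)) =
      E.flatMap fun K => pieceIdeals (boundaryPieces K) := by
  induction E with
  | nil => rfl
  | cons K rest ih =>
    by_cases hK : K = ⊤
    · subst hK
      rw [removeEmpty_cons_top, ih, List.flatMap_cons, boundaryPieces_top]
      rfl
    · rw [removeEmpty_cons_of_ne_top hK, List.flatMap_cons, List.flatMap_cons, ih]

/-- **Boundaries with the same non-empty members have the same split boundary.** [folklore] -/
theorem flatMap_boundaryPieces_eq_of_removeEmpty_eq {E₁ E₂ : List X.IdealSheafData}
    (h : removeEmpty E₁ = removeEmpty E₂) :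
    (E₁.flatMap fun K => pieceIdeals (boundaryPieces K)) =
      E₂.flatMap fun K => pieceIdeals (boundaryPieces K) := by
  rw [← flatMap_boundaryPieces_removeEmpty E₁, ← flatMap_boundaryPieces_removeEmpty E₂, h]

namespace Triple

variable {k : Type u} [Field k] {n : ℕ} (T : Triple k n) (E : List T.X.IdealSheafData)
  (hE : HasSNC E) (hE' : E.Pairwise fun D D' => D = D' → D = ⊤)
  (hrem : removeEmpty E = removeEmpty T.boundary)
include hrem

/-- Changing the boundary by empty divisors does not change the split boundary. [folklore] -/
theorem splitBoundary_withBoundary : (T.withBoundary E hE hE').splitBoundary = T.splitBoundary :=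
  flatMap_boundaryPieces_eq_of_removeEmpty_eq hrem

/-- … nor the componentwise monomial part. [cite: Kollar2007, Def.–Lemma 3.110 (p. 176)] -/
theorem mPart_withBoundary : (T.withBoundary E hE hE').mPart = T.mPart := by
  rw [Triple.mPart, Triple.mPart, splitBoundary_withBoundary T E hE hE' hrem]
  rfl

/-- … nor the componentwise nonmonomial part `N(I)`. [cite: Kollar2007, Def.–Lemma 3.110 (p. 176)] -/
theorem nmPart_withBoundary : (T.withBoundary E hE hE').nmPart = T.nmPart := by
  rw [Triple.nmPart, Triple.nmPart, splitBoundary_withBoundary T E hE hE' hrem]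
  rfl

/-- **`(X, N(I), E')` for `T` with the boundary `E'` is `(X, N(I), E)` with the boundary `E'`**:
the triple of Step 1 ignores empty divisors in the sense of clause (3).
[cite: Kollar2007, 3.111 Step 1 (p. 176) with 3.32 (p. 130)] -/
theorem withNmPart_withBoundary :
    (T.withBoundary E hE hE').withNmPart = T.withNmPart.withBoundary E hE hE' := by
  have h := nmPart_withBoundary T E hE hE' hrem
  -- both sides are `⟨X, f, _, _, ideal, _, E, hE, hE'⟩` with propositionally equal ideals
  show (⟨T.X, T.struct, T.isRegular, T.equidim, (T.withBoundary E hE hE').nmPart,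
      (T.withBoundary E hE hE').stalkIdeal_nmPart_ne_bot, E, hE, hE'⟩ : Triple k n) =
    ⟨T.X, T.struct, T.isRegular, T.equidim, T.nmPart, T.stalkIdeal_nmPart_ne_bot, E, hE, hE'⟩
  congr 1

end Triple

end Kollar2007

end Literature.AlgebraicGeometry.Resolution

end
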